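import Mathlib.Analysis.SpecialFunctions.SmoothTransition
import Mathlib.Analysis.Calculus.Deriv.Shift
import Mathlib.Analysis.SpecialFunctions.Gaussian.GaussianIntegral
import Mathlib.Analysis.SpecialFunctions.Gaussian.FourierTransform
import Mathlib.Analysis.SpecialFunctions.Trigonometric.DerivHyp
import Mathlib.Analysis.Normed.Group.Tannery
import Literature.NumberTheory.LFunctions.ZetaHeatExpansion
import Literature.NumberTheory.LFunctions.WeilMellinBounds
import Literature.NumberTheory.LFunctions.WeilZeroSum
import Literature.NumberTheory.LFunctions.ZetaZerosJensen
import Literature.NumberTheory.LFunctions.WeilExplicitFormulaProofs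
import Literature.NumberTheory.LFunctions.WeilExplicitArchTermProofs
import HarnessLib

/-!
# The explicit formula for the Gaussian (heat) test function `F_t` (Connes 2024, §§2–3), under RH:
# `Σ_ρ m(ρ) e^{−tγ²} = 2e^{t/4} − ψ(t) − W_ℝ(F_t)` (PROVED)

LABEL (line 1): RH-FREE analysis of the Guinand–Weil explicit formula; RH enters ONLY as the printed hypothesis that
puts the zeros on the critical line (so that the zero side is the heat trace `Σ m(ρ)e^{−tγ²}`).  Part (A) of the
discharge of the named fact `Literature.NumberTheory.LFunctions.Connes2024_heat_thm_1_1` (`ZetaHeatExpansion.lean`,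
Connes 2024 Thm 1.1 = Connes 2026 Letter Thm 7.3, CONDITIONAL ON RH as printed).  Cell `rh-crit`, sub-cell `cc/`,
row O1.  bears_on: W-C/W-P (C1) record only.  WHAT THIS IS NOT: anything bearing on the truth of RH.

Source: A. Connes, *Heat expansion and zeta*, arXiv:2402.13082 = Ann. Funct. Anal. 15 (2024), §2 (the explicit
formula of [EB] = Bombieri, *The Riemann Hypothesis*, Clay 2006, for `f` smooth with `f(x) = O(x^δ)` at `0`,
`O(x^{−1−δ})` at `∞`, archimedean term `W_ℝ(F) = (log 4π + γ)F(1) + ∫₁^∞ (F(x) + F(x⁻¹) − 2x^{−½}F(1)) x^{½}/(x − x⁻¹) d*x`)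
and §3 first displays: "We choose `F_t` such that `F̂_t(s) = exp(−ts²)`. One has `F_t(e^y) = e^{−y²/4t}/(2√π√t)` …
`Σ_Z exp(−tρ²) = F̂_t(i/2) + F̂_t(−i/2) − W_ℝ(F_t) − ψ(t) = 2exp(t/4) − W_ℝ(F_t) − ψ(t)`" (p0005:L4–L16).

## What is proved, and how (theorems only; no definition, no named fact)

The tree proves the explicit formula for SMOOTH COMPACTLY SUPPORTED test functions (`explicit_formula_holds`,
Bombieri 2000 Thm 2; Bombieri's archimedean form `weilArchTermBombieri_eq_weilArchTerm_holds`), not for the decaying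
class of [EB]; the Gaussian `heatTest t` is not compactly supported.  DEVIATION FROM PRINT (declared): we obtain the
Gaussian case by APPROXIMATION — `g_n = χ_n · heatTest t` with the smooth plateaus
`χ_n(y) = ST(n+2−y)ST(n+2+y)` (`ST = Real.smoothTransition`; `χ_n = 1` on `[−(n+1), n+1]`, `|χ_n'|, |χ_n''|`
bounded uniformly in `n`), the tree's formula for each `g_n`, and `n → ∞` in all four terms:
* zero side: `|ĝ_n(ρ)| ≤ D/(1+γ²)` uniformly (`norm_weilMellin_le`, two integrations by parts,
  `weilDecayConst_cutoff_mul_le`) and, UNDER RH, `Σ m(ρ)/(1+γ²) < ∞` (`ZetaZerosJensen.summable_zeroOrder_div_norm_sq`);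
  dominated convergence for the sum (Tannery) and for each `ĝ_n(ρ) → ĝ(ρ)` (`tendsto_weilMellin_cutoff`);
* polar term `ĝ_n(0) + ĝ_n(1)`, prime term (dominated by the convergent `ψ(t)`, `summable_heatPrimeTerm`, whence the
  restriction `t ≤ (log 6)/8` of §4), and Bombieri's archimedean integral (dominated convergence on `(0,∞)`; on `(0,1]`
  the integrands coincide, `tendsto_bombieriIntegral_cutoff`);
* the Gaussian integrals `ĝ_t(s) = e^{t(s−½)²}` (Mathlib `integral_cexp_quadratic`): `ĝ_t(½+iγ) = e^{−tγ²}`,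
  `ĝ_t(0) + ĝ_t(1) = 2e^{t/4}` (`weilMellin_heatTest`, `weilPolarTerm_heatTest`).

Main results (namespace `Literature.NumberTheory.LFunctions.ZetaHeatExplicit`):
* `tsum_zeroSide_heatTest` — under RH, `0 < t ≤ (log 6)/8`:
  `Σ'_ρ m(ρ) ĝ_t(ρ) = (ĝ_t(0) + ĝ_t(1)) − Σ_n Λ(n)n^{−½}(g_t(log n) + g_t(−log n)) + W_∞^{Bombieri}(g_t)`;
* `zetaHeatTrace_eq` — the same in the vocabulary of `ZetaHeatExpansion.lean`:
  `zetaHeatTrace t = 2e^{t/4} − heatPrimeSum t − ((log 4π + γ)/(2√π√t) + ∫₀^∞ (e^{y/2}h_t(y) − h_t(0))/sinh y dy)`,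
  `h_t(y) = e^{−y²/4t}/(2√π√t)` — the printed `2exp(t/4) − W_ℝ(F_t) − ψ(t)`;
* `summable_zetaHeatTerm` — under RH the heat trace converges for every `t > 0`.
-/

noncomputable section

open Real Filter Set MeasureTheory Topology Complex
open scoped ContDiff

namespace Literature.NumberTheory.LFunctions

namespace ZetaHeatExplicit

/-! ## Smooth cutoffs with uniformly bounded derivatives -/

/-- `smoothTransition' = 0` off `[0, 1]` (it is locally constant there). [folklore] -/
private theorem deriv_smoothTransition_eq_zero {x : ℝ} (hx : x < 0 ∨ 1 < x) :
    deriv Real.smoothTransition x = 0 := by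
  rcases hx with hx | hx
  · have h : Real.smoothTransition =ᶠ[𝓝 x] fun _ => (0 : ℝ) := by
      filter_upwards [Iio_mem_nhds hx] with y hy
      exact Real.smoothTransition.zero_of_nonpos (le_of_lt hy)
    rw [h.deriv_eq, deriv_const]
  · have h : Real.smoothTransition =ᶠ[𝓝 x] fun _ => (1 : ℝ) := by
      filter_upwards [Ioi_mem_nhds hx] with y hy
      exact Real.smoothTransition.one_of_one_le (le_of_lt hy)
    rw [h.deriv_eq, deriv_const]

/-- `smoothTransition'` has compact support (in `[0, 1]`). [folklore] -/
private theorem hasCompactSupport_deriv_smoothTransition :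
    HasCompactSupport (deriv Real.smoothTransition) := by
  refine HasCompactSupport.intro (isCompact_Icc (a := (0 : ℝ)) (b := 1)) fun x hx => ?_
  rw [mem_Icc, not_and_or, not_le, not_le] at hx
  exact deriv_smoothTransition_eq_zero hx

/-- `smoothTransition` is `C^∞`, with the smoothness exponent spelled `∞`. [folklore] -/
private theorem contDiff_smoothTransition : ContDiff ℝ ∞ Real.smoothTransition :=
  Real.smoothTransition.contDiff

/-- **Uniform bound for the first two derivatives of `smoothTransition`**: there is `M ≥ 1` with
`|ST'(x)| ≤ M` and `|ST''(x)| ≤ M` for all `x` (continuous functions with compact support). [folklore] -/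
private theorem exists_bound_deriv_smoothTransition :
    ∃ M : ℝ, 1 ≤ M ∧ (∀ x, |deriv Real.smoothTransition x| ≤ M) ∧
      ∀ x, |deriv (deriv Real.smoothTransition) x| ≤ M := by
  have h1c : Continuous (deriv Real.smoothTransition) :=
    contDiff_smoothTransition.continuous_deriv (by simp)
  have h2c : Continuous (deriv (deriv Real.smoothTransition)) := by
    have := (contDiff_smoothTransition.iterate_deriv 2).continuous
    simpa using this
  obtain ⟨C₁, hC₁⟩ := h1c.bounded_above_of_compact_support hasCompactSupport_deriv_smoothTransition
  obtain ⟨C₂, hC₂⟩ := h2c.bounded_above_of_compact_support hasCompactSupport_deriv_smoothTransition.deriv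
  refine ⟨max 1 (max C₁ C₂), le_max_left _ _, fun x => ?_, fun x => ?_⟩
  · exact (Real.norm_eq_abs _ ▸ hC₁ x).trans ((le_max_left _ _).trans (le_max_right _ _))
  · exact (Real.norm_eq_abs _ ▸ hC₂ x).trans ((le_max_right _ _).trans (le_max_right _ _))

/-- The cutoff `χ_c(y) = ST(c − y)·ST(c + y)`: smooth. [folklore] -/
private theorem contDiff_cutoff (c : ℝ) :
    ContDiff ℝ ∞ (fun y : ℝ => Real.smoothTransition (c - y) * Real.smoothTransition (c + y)) := by
  have h1 : ContDiff ℝ ∞ (fun y : ℝ => c - y) := contDiff_const.sub contDiff_id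
  have h2 : ContDiff ℝ ∞ (fun y : ℝ => c + y) := contDiff_const.add contDiff_id
  exact (contDiff_smoothTransition.comp h1).mul (contDiff_smoothTransition.comp h2)

/-- The cutoff vanishes off `[−c, c]`. [folklore] -/
private theorem cutoff_eq_zero {c y : ℝ} (hy : c ≤ |y|) :
    Real.smoothTransition (c - y) * Real.smoothTransition (c + y) = 0 := by
  rcases le_or_gt 0 y with h | h
  · rw [abs_of_nonneg h] at hy
    rw [Real.smoothTransition.zero_of_nonpos (by linarith), zero_mul]
  · rw [abs_of_neg h] at hy
    rw [Real.smoothTransition.zero_of_nonpos (x := c + y) (by linarith), mul_zero]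

/-- The cutoff has compact support. [folklore] -/
private theorem hasCompactSupport_cutoff (c : ℝ) :
    HasCompactSupport (fun y : ℝ => Real.smoothTransition (c - y) * Real.smoothTransition (c + y)) := by
  refine HasCompactSupport.intro (isCompact_Icc (a := -|c|) (b := |c|)) fun y hy => ?_
  apply cutoff_eq_zero
  rw [mem_Icc, not_and_or, not_le, not_le] at hy
  have hc : 0 ≤ |c| := abs_nonneg c
  rcases hy with hy | hy
  · rw [abs_of_neg (by linarith : y < 0)]; linarith [le_abs_self c]
  · rw [abs_of_pos (by linarith : 0 < y)]; linarith [le_abs_self c]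

/-- The cutoff equals `1` on `[−(c−1), c−1]`. [folklore] -/
private theorem cutoff_eq_one {c y : ℝ} (hy : |y| ≤ c - 1) :
    Real.smoothTransition (c - y) * Real.smoothTransition (c + y) = 1 := by
  have h1 : 1 ≤ c - y := by linarith [le_abs_self y]
  have h2 : 1 ≤ c + y := by linarith [neg_abs_le y]
  rw [Real.smoothTransition.one_of_one_le h1, Real.smoothTransition.one_of_one_le h2, mul_one]

/-- `0 ≤ χ_c ≤ 1`. [folklore] -/
private theorem abs_cutoff_le_one (c y : ℝ) :
    |Real.smoothTransition (c - y) * Real.smoothTransition (c + y)| ≤ 1 := by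
  rw [abs_mul, abs_of_nonneg (Real.smoothTransition.nonneg _),
    abs_of_nonneg (Real.smoothTransition.nonneg _)]
  exact mul_le_one₀ (Real.smoothTransition.le_one _) (Real.smoothTransition.nonneg _)
    (Real.smoothTransition.le_one _)

/-- First derivative of the cutoff: `χ_c' (y) = −ST'(c−y) ST(c+y) + ST(c−y) ST'(c+y)`. [folklore] -/
private theorem deriv_cutoff (c : ℝ) :
    deriv (fun y : ℝ => Real.smoothTransition (c - y) * Real.smoothTransition (c + y)) =
      fun y => -deriv Real.smoothTransition (c - y) * Real.smoothTransition (c + y) +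
        Real.smoothTransition (c - y) * deriv Real.smoothTransition (c + y) := by
  have hd : Differentiable ℝ Real.smoothTransition := contDiff_smoothTransition.differentiable (by simp)
  funext y
  have ha : DifferentiableAt ℝ (fun y : ℝ => Real.smoothTransition (c - y)) y :=
    (hd _).comp y ((differentiableAt_const c).sub differentiableAt_id)
  have hb : DifferentiableAt ℝ (fun y : ℝ => Real.smoothTransition (c + y)) y :=
    (hd _).comp y ((differentiableAt_const c).add differentiableAt_id)
  rw [deriv_fun_mul ha hb, deriv_comp_const_sub, deriv_comp_const_add]

/-- Second derivative of the cutoff. [folklore] -/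
private theorem deriv_deriv_cutoff (c : ℝ) :
    deriv (deriv (fun y : ℝ => Real.smoothTransition (c - y) * Real.smoothTransition (c + y))) =
      fun y => deriv (deriv Real.smoothTransition) (c - y) * Real.smoothTransition (c + y) -
        2 * (deriv Real.smoothTransition (c - y) * deriv Real.smoothTransition (c + y)) +
        Real.smoothTransition (c - y) * deriv (deriv Real.smoothTransition) (c + y) := by
  have hd : Differentiable ℝ Real.smoothTransition := contDiff_smoothTransition.differentiable (by simp)
  have hd1 : Differentiable ℝ (deriv Real.smoothTransition) :=
    (contDiff_smoothTransition.iterate_deriv 1).differentiable (by simp)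
  rw [deriv_cutoff]
  funext y
  have hlin1 : DifferentiableAt ℝ (fun y : ℝ => c - y) y := (differentiableAt_const c).sub differentiableAt_id
  have hlin2 : DifferentiableAt ℝ (fun y : ℝ => c + y) y := (differentiableAt_const c).add differentiableAt_id
  have ha : DifferentiableAt ℝ (fun y : ℝ => Real.smoothTransition (c - y)) y := (hd _).comp y hlin1
  have hb : DifferentiableAt ℝ (fun y : ℝ => Real.smoothTransition (c + y)) y := (hd _).comp y hlin2
  have ha' : DifferentiableAt ℝ (fun y : ℝ => -deriv Real.smoothTransition (c - y)) y :=
    ((hd1 _).comp y hlin1).neg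
  have hb' : DifferentiableAt ℝ (fun y : ℝ => deriv Real.smoothTransition (c + y)) y :=
    (hd1 _).comp y hlin2
  rw [deriv_fun_add (ha'.fun_mul hb) (ha.fun_mul hb'), deriv_fun_mul ha' hb, deriv_fun_mul ha hb',
    deriv.fun_neg, deriv_comp_const_sub, deriv_comp_const_add, deriv_comp_const_sub,
    deriv_comp_const_add (f := deriv Real.smoothTransition)]
  ring

/-- **Uniform derivative bounds for the cutoffs**: with `M` as in `exists_bound_deriv_smoothTransition`,
`|χ_c'| ≤ 2M` and `|χ_c''| ≤ 4M²` for every `c`. [folklore] -/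
private theorem abs_deriv_cutoff_le {M : ℝ} (hM1 : 1 ≤ M) (hM : ∀ x, |deriv Real.smoothTransition x| ≤ M)
    (hM' : ∀ x, |deriv (deriv Real.smoothTransition) x| ≤ M) (c y : ℝ) :
    |deriv (fun y : ℝ => Real.smoothTransition (c - y) * Real.smoothTransition (c + y)) y| ≤ 2 * M ∧
      |deriv (deriv (fun y : ℝ => Real.smoothTransition (c - y) * Real.smoothTransition (c + y))) y|
        ≤ 4 * M ^ 2 := by
  have hS : ∀ x, |Real.smoothTransition x| ≤ 1 := fun x => by
    rw [abs_of_nonneg (Real.smoothTransition.nonneg _)]; exact Real.smoothTransition.le_one _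
  constructor
  · rw [deriv_cutoff]
    calc _ ≤ |(-deriv Real.smoothTransition (c - y)) * Real.smoothTransition (c + y)| +
          |Real.smoothTransition (c - y) * deriv Real.smoothTransition (c + y)| := abs_add_le _ _
      _ ≤ M * 1 + 1 * M := by
          rw [abs_mul, abs_mul, abs_neg]
          gcongr
          · exact hM _
          · exact hS _
          · exact hS _
          · exact hM _
      _ = 2 * M := by ring
  · rw [deriv_deriv_cutoff]
    calc _ ≤ |deriv (deriv Real.smoothTransition) (c - y) * Real.smoothTransition (c + y) -
            2 * (deriv Real.smoothTransition (c - y) * deriv Real.smoothTransition (c + y))| +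
          |Real.smoothTransition (c - y) * deriv (deriv Real.smoothTransition) (c + y)| := abs_add_le _ _
      _ ≤ (|deriv (deriv Real.smoothTransition) (c - y) * Real.smoothTransition (c + y)| +
            |2 * (deriv Real.smoothTransition (c - y) * deriv Real.smoothTransition (c + y))|) +
          |Real.smoothTransition (c - y) * deriv (deriv Real.smoothTransition) (c + y)| := by
          gcongr; exact abs_sub _ _
      _ ≤ (M * 1 + 2 * (M * M)) + 1 * M := by
          rw [abs_mul, abs_mul, abs_mul, abs_mul, abs_two]
          gcongr
          · exact hM' _
          · exact hS _
          · exact hM _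
          · exact hM _
          · exact hS _
          · exact hM' _
      _ ≤ 4 * M ^ 2 := by nlinarith

/-! ## The Gaussian profile `h_t(y) = e^{−y²/4t}/(2√π√t)` and its first two derivatives -/

/-- `h_t' (y) = −(y/2t) h_t(y)`. [folklore] -/
private theorem hasDerivAt_profile {t : ℝ} (ht : 0 < t) (y : ℝ) :
    HasDerivAt (fun y : ℝ => Real.exp (-y ^ 2 / (4 * t)) / (2 * √π * √t))
      (-(y / (2 * t)) * (Real.exp (-y ^ 2 / (4 * t)) / (2 * √π * √t))) y := by
  have h1 : HasDerivAt (fun y : ℝ => -y ^ 2 / (4 * t)) (-(2 * y) / (4 * t)) y := by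
    have := ((hasDerivAt_pow 2 y).neg).div_const (4 * t)
    simpa using this
  have h2 := (h1.exp).div_const (2 * √π * √t)
  refine h2.congr_deriv ?_
  field_simp
  ring

/-- `deriv h_t = −(y/2t) h_t`. [folklore] -/
private theorem deriv_profile {t : ℝ} (ht : 0 < t) :
    deriv (fun y : ℝ => Real.exp (-y ^ 2 / (4 * t)) / (2 * √π * √t)) =
      fun y => -(y / (2 * t)) * (Real.exp (-y ^ 2 / (4 * t)) / (2 * √π * √t)) :=
  funext fun y => (hasDerivAt_profile ht y).deriv

/-- `h_t'' (y) = (y²/4t² − 1/2t) h_t(y)`. [folklore] -/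
private theorem deriv_deriv_profile {t : ℝ} (ht : 0 < t) :
    deriv (deriv (fun y : ℝ => Real.exp (-y ^ 2 / (4 * t)) / (2 * √π * √t))) =
      fun y => (y ^ 2 / (4 * t ^ 2) - 1 / (2 * t)) * (Real.exp (-y ^ 2 / (4 * t)) / (2 * √π * √t)) := by
  rw [deriv_profile ht]
  funext y
  have h1 : HasDerivAt (fun y : ℝ => -(y / (2 * t))) (-(1 / (2 * t))) y := by
    have := ((hasDerivAt_id y).div_const (2 * t)).neg
    simpa [Pi.neg_def] using this
  have h := h1.fun_mul (hasDerivAt_profile ht y)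
  rw [h.deriv]
  field_simp
  ring

/-- `h_t` is smooth. [folklore] -/
private theorem contDiff_profile {t : ℝ} :
    ContDiff ℝ ∞ (fun y : ℝ => Real.exp (-y ^ 2 / (4 * t)) / (2 * √π * √t)) := by
  have h1 : ContDiff ℝ ∞ (fun y : ℝ => -y ^ 2 / (4 * t)) :=
    ((contDiff_id.pow 2).neg).div_const _
  exact (Real.contDiff_exp.comp h1).div_const _

/-- `h_t > 0`. [folklore] -/
private theorem profile_pos {t : ℝ} (ht : 0 < t) (y : ℝ) :
    0 < Real.exp (-y ^ 2 / (4 * t)) / (2 * √π * √t) := by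
  have : 0 < √π := Real.sqrt_pos.mpr Real.pi_pos
  have : 0 < √t := Real.sqrt_pos.mpr ht
  positivity

/-- **Completing the square**: `e^{−y²/4t} e^{|y|/2} ≤ e^{t/2} e^{−y²/8t}`. [folklore] -/
private theorem exp_mul_exp_abs_le {t : ℝ} (ht : 0 < t) (y : ℝ) :
    Real.exp (-y ^ 2 / (4 * t)) * Real.exp (|y| / 2) ≤ Real.exp (t / 2) * Real.exp (-y ^ 2 / (8 * t)) := by
  rw [← Real.exp_add, ← Real.exp_add, Real.exp_le_exp]
  have h8 : 0 < 8 * t := by linarith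
  rw [show -y ^ 2 / (4 * t) + |y| / 2 = (-2 * y ^ 2 + 4 * t * |y|) / (8 * t) by field_simp; ring,
    show t / 2 + -y ^ 2 / (8 * t) = (4 * t ^ 2 - y ^ 2) / (8 * t) by field_simp; ring,
    div_le_div_iff_of_pos_right h8]
  nlinarith [sq_nonneg (|y| - 2 * t), sq_abs y]

/-- The integrable Gaussian majorant `(K₀ + K₁|y| + K₂y²) e^{−y²/8t}`. [folklore] -/
private theorem integrable_majorant {t : ℝ} (ht : 0 < t) (K₀ K₁ K₂ : ℝ) :
    Integrable fun y : ℝ => (K₀ + K₁ * |y| + K₂ * y ^ 2) * Real.exp (-y ^ 2 / (8 * t)) := by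
  have hb : 0 < 1 / (8 * t) := by positivity
  have e : ∀ y : ℝ, Real.exp (-y ^ 2 / (8 * t)) = Real.exp (-(1 / (8 * t)) * y ^ 2) := by
    intro y; congr 1; field_simp
  simp_rw [e]
  have i0 := (integrable_exp_neg_mul_sq hb).const_mul K₀
  have i1 := ((integrable_mul_exp_neg_mul_sq hb).norm).const_mul K₁
  have i2 := ((integrable_rpow_mul_exp_neg_mul_sq hb (s := 2) (by norm_num))).const_mul K₂
  refine ((i0.add i1).add i2).congr (Eventually.of_forall fun y => ?_)
  simp only [Pi.add_apply, norm_mul, Real.norm_eq_abs, abs_of_pos (Real.exp_pos _),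
    Real.rpow_two]
  ring

/-! ## Cut-off Gaussians are test functions with uniformly bounded decay constant -/

/-- For a smooth compactly supported real cutoff `χ`, `y ↦ χ(y) h_t(y)` (as a complex function) is a Weil test
function, and it is `ofReal ∘ (χ·h_t)`. [folklore] -/
private theorem isWeilTest_cutoff_mul {t : ℝ} {χ : ℝ → ℝ} (hχ : ContDiff ℝ ∞ χ)
    (hχc : HasCompactSupport χ) :
    IsWeilTest (fun y : ℝ => (χ y : ℂ) * heatTest t y) := by
  have e : (fun y : ℝ => (χ y : ℂ) * heatTest t y) =
      fun y => (((χ y * (Real.exp (-y ^ 2 / (4 * t)) / (2 * √π * √t))) : ℝ) : ℂ) := by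
    funext y; simp only [heatTest]; push_cast; ring
  rw [e]
  refine ⟨?_, ?_⟩
  · exact (Complex.ofRealCLM.contDiff.comp (hχ.mul contDiff_profile))
  · exact (hχc.mul_right (f' := fun y : ℝ => Real.exp (-y ^ 2 / (4 * t)) / (2 * √π * √t))).comp_left
      Complex.ofReal_zero

/-- Derivative of `ofReal ∘ p` for differentiable real `p`. [folklore] -/
private theorem deriv_ofReal_comp {p : ℝ → ℝ} (hp : Differentiable ℝ p) :
    deriv (fun y : ℝ => ((p y : ℝ) : ℂ)) = fun y => ((deriv p y : ℝ) : ℂ) :=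
  funext fun y => ((hp y).hasDerivAt.ofReal_comp).deriv

/-- **Pointwise bound for `(χ h_t)''`**: with `|χ| ≤ 1`, `|χ'|, |χ''| ≤ B` (`B ≥ 1`),
`|(χ h_t)''(y)| ≤ (B + 1/2t + (B/t)|y| + y²/4t²) h_t(y)`, and the same majorant bounds `|χ h_t|`. [folklore] -/
private theorem abs_deriv_deriv_cutoff_mul_le {t : ℝ} (ht : 0 < t) {χ : ℝ → ℝ} (hχ : ContDiff ℝ ∞ χ)
    {B : ℝ} (hB : 1 ≤ B) (h0 : ∀ y, |χ y| ≤ 1) (h1 : ∀ y, |deriv χ y| ≤ B)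
    (h2 : ∀ y, |deriv (deriv χ) y| ≤ B) (y : ℝ) :
    |deriv (deriv (fun y : ℝ => χ y * (Real.exp (-y ^ 2 / (4 * t)) / (2 * √π * √t)))) y| ≤
      (B + 1 / (2 * t) + B / t * |y| + y ^ 2 / (4 * t ^ 2)) *
        (Real.exp (-y ^ 2 / (4 * t)) / (2 * √π * √t)) ∧
    |χ y * (Real.exp (-y ^ 2 / (4 * t)) / (2 * √π * √t))| ≤
      (B + 1 / (2 * t) + B / t * |y| + y ^ 2 / (4 * t ^ 2)) *
        (Real.exp (-y ^ 2 / (4 * t)) / (2 * √π * √t)) := by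
  set h : ℝ → ℝ := fun y : ℝ => Real.exp (-y ^ 2 / (4 * t)) / (2 * √π * √t) with hh
  have hpos := profile_pos ht y
  have hχd : Differentiable ℝ χ := hχ.differentiable (by simp)
  have hχd1 : Differentiable ℝ (deriv χ) := (hχ.iterate_deriv 1).differentiable (by simp)
  have hhd : Differentiable ℝ h := contDiff_profile.differentiable (by simp)
  have hhd1 : Differentiable ℝ (deriv h) := (contDiff_profile.iterate_deriv 1).differentiable (by simp)
  -- the second derivative of the product
  have hprod1 : deriv (fun y => χ y * h y) = fun y => deriv χ y * h y + χ y * deriv h y :=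
    funext fun y => deriv_fun_mul (hχd y) (hhd y)
  have hprod2 : deriv (deriv (fun y => χ y * h y)) y =
      deriv (deriv χ) y * h y + 2 * (deriv χ y * deriv h y) + χ y * deriv (deriv h) y := by
    rw [hprod1, deriv_fun_add ((hχd1 y).fun_mul (hhd y)) ((hχd y).fun_mul (hhd1 y)),
      deriv_fun_mul (hχd1 y) (hhd y), deriv_fun_mul (hχd y) (hhd1 y)]
    ring
  have hd1 : deriv h y = -(y / (2 * t)) * h y := by rw [hh, deriv_profile ht]
  have hd2 : deriv (deriv h) y = (y ^ 2 / (4 * t ^ 2) - 1 / (2 * t)) * h y := by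
    rw [hh, deriv_deriv_profile ht]
  have hyt : 0 ≤ |y| / (2 * t) := by positivity
  have hy2 : 0 ≤ y ^ 2 / (4 * t ^ 2) := by positivity
  have ht' : 0 ≤ 1 / (2 * t) := by positivity
  constructor
  · rw [hprod2, hd1, hd2]
    have e1 : |deriv (deriv χ) y * h y| ≤ B * h y := by
      rw [abs_mul, abs_of_pos hpos]; exact mul_le_mul_of_nonneg_right (h2 y) hpos.le
    have e2 : |2 * (deriv χ y * (-(y / (2 * t)) * h y))| ≤ 2 * (B * (|y| / (2 * t) * h y)) := by
      rw [abs_mul, abs_two, abs_mul, abs_mul, abs_neg, abs_div, abs_of_pos (by linarith : 0 < 2 * t),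
        abs_of_pos hpos]
      gcongr
      exact h1 y
    have e3 : |χ y * ((y ^ 2 / (4 * t ^ 2) - 1 / (2 * t)) * h y)| ≤
        1 * ((y ^ 2 / (4 * t ^ 2) + 1 / (2 * t)) * h y) := by
      rw [abs_mul, abs_mul, abs_of_pos hpos]
      gcongr
      · exact h0 y
      · exact (abs_sub _ _).trans (by rw [abs_of_nonneg hy2, abs_of_nonneg ht'])
    calc _ ≤ |deriv (deriv χ) y * h y + 2 * (deriv χ y * (-(y / (2 * t)) * h y))| +
          |χ y * ((y ^ 2 / (4 * t ^ 2) - 1 / (2 * t)) * h y)| := abs_add_le _ _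
      _ ≤ (|deriv (deriv χ) y * h y| + |2 * (deriv χ y * (-(y / (2 * t)) * h y))|) +
          |χ y * ((y ^ 2 / (4 * t ^ 2) - 1 / (2 * t)) * h y)| := by gcongr; exact abs_add_le _ _
      _ ≤ (B * h y + 2 * (B * (|y| / (2 * t) * h y))) + 1 * ((y ^ 2 / (4 * t ^ 2) + 1 / (2 * t)) * h y) := by
          gcongr
      _ = (B + 1 / (2 * t) + B / t * |y| + y ^ 2 / (4 * t ^ 2)) * h y := by
          field_simp
          ring
  · rw [abs_mul, abs_of_pos hpos]
    have hB' : |χ y| ≤ B + 1 / (2 * t) + B / t * |y| + y ^ 2 / (4 * t ^ 2) := by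
      have : 0 ≤ B / t * |y| := by positivity
      linarith [h0 y]
    exact mul_le_mul_of_nonneg_right hB' hpos.le

/-- **Uniform decay constant**: for a smooth compactly supported cutoff `χ` with `|χ| ≤ 1`, `|χ'|, |χ''| ≤ B`,
`weilDecayConst (χ h_t) ≤ 2 e^{t/2}/(2√π√t) ∫ (B + 1/2t + (B/t)|y| + y²/4t²) e^{−y²/8t} dy` — a bound
independent of `χ`. [folklore] -/
private theorem weilDecayConst_cutoff_mul_le {t : ℝ} (ht : 0 < t) {χ : ℝ → ℝ} (hχ : ContDiff ℝ ∞ χ)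
    {B : ℝ} (hB : 1 ≤ B) (h0 : ∀ y, |χ y| ≤ 1) (h1 : ∀ y, |deriv χ y| ≤ B)
    (h2 : ∀ y, |deriv (deriv χ) y| ≤ B) :
    weilDecayConst (fun y : ℝ => (χ y : ℂ) * heatTest t y) ≤
      2 * (Real.exp (t / 2) / (2 * √π * √t) *
        ∫ y : ℝ, (B + 1 / (2 * t) + B / t * |y| + 1 / (4 * t ^ 2) * y ^ 2) * Real.exp (-y ^ 2 / (8 * t))) := by
  set h : ℝ → ℝ := fun y : ℝ => Real.exp (-y ^ 2 / (4 * t)) / (2 * √π * √t) with hh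
  set p : ℝ → ℝ := fun y => χ y * h y with hp
  have hsq : 0 < 2 * √π * √t := by
    have : 0 < √π := Real.sqrt_pos.mpr Real.pi_pos
    have : 0 < √t := Real.sqrt_pos.mpr ht
    positivity
  have e : (fun y : ℝ => (χ y : ℂ) * heatTest t y) = fun y => ((p y : ℝ) : ℂ) := by
    funext y; simp only [hp, hh, heatTest]; push_cast; ring
  have hpd : ContDiff ℝ ∞ p := hχ.mul contDiff_profile
  have hpdiff : Differentiable ℝ p := hpd.differentiable (by simp)
  have hpdiff1 : Differentiable ℝ (deriv p) := (hpd.iterate_deriv 1).differentiable (by simp)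
  have hd2 : deriv (deriv (fun y : ℝ => ((p y : ℝ) : ℂ))) = fun y => ((deriv (deriv p) y : ℝ) : ℂ) := by
    rw [deriv_ofReal_comp hpdiff, deriv_ofReal_comp hpdiff1]
  -- the common integrable majorant
  set M : ℝ → ℝ := fun y => Real.exp (t / 2) / (2 * √π * √t) *
    ((B + 1 / (2 * t) + B / t * |y| + 1 / (4 * t ^ 2) * y ^ 2) * Real.exp (-y ^ 2 / (8 * t))) with hM
  have hMi : Integrable M := (integrable_majorant ht _ _ _).const_mul _
  have hbound : ∀ y, (B + 1 / (2 * t) + B / t * |y| + y ^ 2 / (4 * t ^ 2)) * h y * Real.exp (|y| / 2)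
      ≤ M y := by
    intro y
    have hq : 0 ≤ B + 1 / (2 * t) + B / t * |y| + y ^ 2 / (4 * t ^ 2) := by positivity
    have := exp_mul_exp_abs_le ht y
    calc (B + 1 / (2 * t) + B / t * |y| + y ^ 2 / (4 * t ^ 2)) * h y * Real.exp (|y| / 2)
        = (B + 1 / (2 * t) + B / t * |y| + y ^ 2 / (4 * t ^ 2)) / (2 * √π * √t) *
            (Real.exp (-y ^ 2 / (4 * t)) * Real.exp (|y| / 2)) := by
          simp only [hh]; field_simp
      _ ≤ (B + 1 / (2 * t) + B / t * |y| + y ^ 2 / (4 * t ^ 2)) / (2 * √π * √t) *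
            (Real.exp (t / 2) * Real.exp (-y ^ 2 / (8 * t))) :=
          mul_le_mul_of_nonneg_left this (by positivity)
      _ = M y := by simp only [hM]; field_simp
  have hL1 : ∀ q : ℝ → ℝ, (∀ y, |q y| ≤ (B + 1 / (2 * t) + B / t * |y| + y ^ 2 / (4 * t ^ 2)) * h y) →
      weilL1 (fun y => ((q y : ℝ) : ℂ)) ≤ ∫ y, M y := by
    intro q hq
    unfold weilL1
    refine integral_mono_of_nonneg (Eventually.of_forall fun y => by positivity) hMi
      (Eventually.of_forall fun y => ?_)
    dsimp only
    rw [Complex.norm_real, Real.norm_eq_abs]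
    exact (mul_le_mul_of_nonneg_right (hq y) (Real.exp_pos _).le).trans (hbound y)
  have hb2 := fun y => (abs_deriv_deriv_cutoff_mul_le ht hχ hB h0 h1 h2 y)
  unfold weilDecayConst
  rw [e, hd2]
  have i1 := hL1 p fun y => (hb2 y).2
  have i2 := hL1 (deriv (deriv p)) fun y => (hb2 y).1
  have eM : ∫ y, M y = Real.exp (t / 2) / (2 * √π * √t) *
      ∫ y : ℝ, (B + 1 / (2 * t) + B / t * |y| + 1 / (4 * t ^ 2) * y ^ 2) * Real.exp (-y ^ 2 / (8 * t)) :=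
    integral_const_mul _ _
  linarith

/-! ## The Mellin–Laplace transform of the Gaussian: `ĝ_t(s) = e^{t(s−½)²}` -/

/-- **`ĝ_t(s) = e^{t(s − ½)²}`** for the heat test function `g_t = heatTest t` (Connes: "We choose `F_t` such that
`F̂_t(s) = exp(−ts²)`"; with `s ↦ ½ + is` this is `e^{−ts²}`), from Mathlib's `integral_cexp_quadratic`.
[cite: Connes2024HeatExpansion, §3 first display (arXiv p0005:L4)] -/
theorem weilMellin_heatTest {t : ℝ} (ht : 0 < t) (s : ℂ) :
    weilMellin (heatTest t) s = cexp (t * (s - 1 / 2) ^ 2) := by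
  unfold weilMellin heatTest
  have hsq : 0 < 2 * √π * √t := by
    have : 0 < √π := Real.sqrt_pos.mpr Real.pi_pos
    have : 0 < √t := Real.sqrt_pos.mpr ht
    positivity
  set b : ℂ := -(1 / (4 * t) : ℝ) with hb
  have hbre : b.re < 0 := by
    rw [hb, neg_re, ofReal_re, neg_lt_zero]; positivity
  have e : ∀ y : ℝ, ((Real.exp (-y ^ 2 / (4 * t)) / (2 * √π * √t) : ℝ) : ℂ) * cexp ((s - 1 / 2) * y) =
      (1 / (2 * √π * √t) : ℝ) * cexp (b * y ^ 2 + (s - 1 / 2) * y + 0) := by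
    intro y
    rw [add_zero, Complex.exp_add, hb]
    push_cast
    rw [show -(1 / (4 * (t : ℂ))) * (y : ℂ) ^ 2 = -(y : ℂ) ^ 2 / (4 * t) by ring]
    ring
  simp_rw [e]
  rw [integral_const_mul, integral_cexp_quadratic hbre]
  have hpi : (π : ℂ) / -b = ((4 * π * t : ℝ) : ℂ) := by
    rw [hb, neg_neg]; push_cast; field_simp
  have hsq' : Real.sqrt (4 * π * t) = 2 * √π * √t := by
    rw [show (4 : ℝ) * π * t = (2 ^ 2) * (π * t) by ring, Real.sqrt_mul (by positivity), Real.sqrt_sq (by norm_num),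
      Real.sqrt_mul Real.pi_pos.le]; ring
  have hcp : ((4 * π * t : ℝ) : ℂ) ^ (1 / 2 : ℂ) = ((2 * √π * √t : ℝ) : ℂ) := by
    rw [show (1 / 2 : ℂ) = ((1 / 2 : ℝ) : ℂ) by push_cast; ring, ← Complex.ofReal_cpow (by positivity),
      ← Real.sqrt_eq_rpow, hsq']
  rw [hpi, hcp, zero_sub]
  have hne : ((2 * √π * √t : ℝ) : ℂ) ≠ 0 := by exact_mod_cast hsq.ne'
  have hexp : -((s - 1 / 2) ^ 2 / (4 * b)) = t * (s - 1 / 2) ^ 2 := by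
    rw [hb]; push_cast; field_simp
  rw [hexp, ← mul_assoc]
  conv_rhs => rw [← one_mul (cexp _)]
  congr 1
  rw [← Complex.ofReal_mul, div_mul_cancel₀ _ hsq.ne', Complex.ofReal_one]

/-- On the critical line: `ĝ_t(½ + iγ) = e^{−tγ²}`. [cite: Connes2024HeatExpansion, §3 (arXiv p0005:L4–L8)] -/
theorem weilMellin_heatTest_half_add {t : ℝ} (ht : 0 < t) (γ : ℝ) :
    weilMellin (heatTest t) (1 / 2 + γ * I) = ((Real.exp (-t * γ ^ 2) : ℝ) : ℂ) := by
  rw [weilMellin_heatTest ht, Complex.ofReal_exp]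
  congr 1
  push_cast
  ring_nf
  rw [Complex.I_sq]
  ring

/-- The polar term: `ĝ_t(0) + ĝ_t(1) = 2e^{t/4}` ("`F̂_t(i/2) + F̂_t(−i/2) = 2exp(t/4)`").
[cite: Connes2024HeatExpansion, §3, display for `Σ_Z exp(−tρ²)` (arXiv p0005:L8)] -/
theorem weilPolarTerm_heatTest {t : ℝ} (ht : 0 < t) :
    weilPolarTerm (heatTest t) = ((2 * Real.exp (t / 4) : ℝ) : ℂ) := by
  rw [weilPolarTerm, weilMellin_heatTest ht, weilMellin_heatTest ht, Complex.ofReal_mul, Complex.ofReal_exp]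
  push_cast
  ring_nf

/-! ## Zero-side weights under RH -/

/-- Under RH every non-trivial zero has real part `½`. [folklore] -/
private theorem re_eq_half {ρ : ℂ} (hRH : RiemannHypothesis) (hρ : ρ ∈ ZetaZeros.riemannZetaNontrivialZeros) :
    ρ.re = 1 / 2 := by
  refine hRH ρ (ZetaZeros.riemannZetaNontrivialZeros.zeta_eq_zero hρ) ?_
    (ZetaZeros.riemannZetaNontrivialZeros.ne_one hρ)
  rintro ⟨n, hn⟩
  have h0 := ZetaZeros.riemannZetaNontrivialZeros.re_pos hρ
  rw [hn] at h0
  simp at h0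
  linarith

/-- **Under RH, `Σ_ρ m(ρ)/(1 + γ²) < ∞`** (from the tree's `Σ_{Re ρ ≥ ¼} m(ρ)/|ρ|² < ∞`,
`ZetaZerosJensen.summable_zeroOrder_div_norm_sq`, and `|ρ|² = ¼ + γ² ≤ 1 + γ²`). [folklore] -/
private theorem summable_zeroOrder_div_one_add_im_sq (hRH : RiemannHypothesis) :
    Summable fun ρ : ZetaZeros.riemannZetaNontrivialZeros =>
      (riemannZetaZeroOrder (ρ : ℂ) : ℝ) / (1 + (ρ : ℂ).im ^ 2) := by
  set i : ZetaZeros.riemannZetaNontrivialZeros → zetaZerosRight := fun ρ =>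
    ⟨ρ, ZetaZeros.riemannZetaNontrivialZeros.zeta_eq_zero ρ.2, by rw [re_eq_half hRH ρ.2]; norm_num⟩ with hi
  have hinj : Function.Injective i := by
    intro a b h
    have : ((i a : zetaZerosRight) : ℂ) = (i b : ℂ) := by rw [h]
    exact Subtype.ext this
  have hs := summable_zeroOrder_div_norm_sq.comp_injective hinj
  have hm : ∀ ρ : ZetaZeros.riemannZetaNontrivialZeros, (0 : ℝ) ≤ riemannZetaZeroOrder (ρ : ℂ) :=
    fun ρ => by
      exact_mod_cast riemannZetaZeroOrder_nonneg (ZetaZeros.riemannZetaNontrivialZeros.ne_one ρ.2)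
  refine Summable.of_nonneg_of_le (fun ρ => div_nonneg (hm ρ) (by positivity)) (fun ρ => ?_) hs
  show (riemannZetaZeroOrder (ρ : ℂ) : ℝ) / (1 + (ρ : ℂ).im ^ 2) ≤
    (riemannZetaZeroOrder (ρ : ℂ) : ℝ) / ‖(ρ : ℂ)‖ ^ 2
  have hnorm : ‖(ρ : ℂ)‖ ^ 2 = 1 / 4 + (ρ : ℂ).im ^ 2 := by
    rw [← Complex.normSq_eq_norm_sq, Complex.normSq_apply, re_eq_half hRH ρ.2]; ring
  have hpos : 0 < ‖(ρ : ℂ)‖ ^ 2 := by rw [hnorm]; positivity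
  exact div_le_div_of_nonneg_left (hm ρ) hpos (by rw [hnorm]; linarith)

/-! ## The explicit formula for a test function, zero side as an absolutely convergent sum -/

/-- For a Weil test function with absolutely convergent zero side,
`Σ'_ρ m(ρ) ĝ(ρ) = ĝ(0) + ĝ(1) − Σ_n Λ(n)n^{−½}(g(log n)+g(−log n)) + W_∞^{Bombieri}(g)` (the tree's
`explicit_formula_holds` and `weilArchTermBombieri_eq_weilArchTerm_holds`). [cite: Connes2024HeatExpansion, §2 eq. for `Σ_ρ f̃(ρ)` and `W_ℝ` (arXiv p0004:L11–L28)] -/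
theorem tsum_zeroSide_eq_bombieri_of_isWeilTest {g : ℝ → ℂ} (hg : IsWeilTest g)
    (hZ : Summable fun ρ : ZetaZeros.riemannZetaNontrivialZeros =>
      ‖(riemannZetaZeroOrder (ρ : ℂ) : ℂ) * weilMellin g ρ‖) :
    ∑' ρ : ZetaZeros.riemannZetaNontrivialZeros, (riemannZetaZeroOrder (ρ : ℂ) : ℂ) * weilMellin g ρ =
      weilPolarTerm g - weilPrimeTerm g + weilArchTermBombieri g := by
  have h := tendsto_nhds_unique (hasWeilZeroSide_tsum hZ) (explicit_formula_holds hg)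
  rw [h, weilFunctional, weilArchTermBombieri_eq_weilArchTerm_holds hg]

/-! ## Pointwise convergence of the transforms of the cut-off Gaussians -/

/-- The weighted Gaussian `h_t(y) e^{|y|/2}` is integrable. [folklore] -/
private theorem integrable_profile_mul_exp_abs {t : ℝ} (ht : 0 < t) :
    Integrable fun y : ℝ => Real.exp (-y ^ 2 / (4 * t)) / (2 * √π * √t) * Real.exp (|y| / 2) := by
  have hb : 0 < 1 / (8 * t) := by positivity
  have hI : Integrable fun y : ℝ => Real.exp (t / 2) / (2 * √π * √t) * Real.exp (-(1 / (8 * t)) * y ^ 2) :=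
    (integrable_exp_neg_mul_sq hb).const_mul _
  refine hI.mono' (by fun_prop) (Eventually.of_forall fun y => ?_)
  have hsq : 0 < 2 * √π * √t := by
    have : 0 < √π := Real.sqrt_pos.mpr Real.pi_pos
    have : 0 < √t := Real.sqrt_pos.mpr ht
    positivity
  rw [Real.norm_of_nonneg (by positivity)]
  have key : Real.exp (-y ^ 2 / (4 * t)) * Real.exp (|y| / 2) ≤ Real.exp (t / 2) * Real.exp (-y ^ 2 / (8 * t)) := by
    rw [← Real.exp_add, ← Real.exp_add, Real.exp_le_exp]
    have h8 : 0 < 8 * t := by linarith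
    rw [show -y ^ 2 / (4 * t) + |y| / 2 = (-2 * y ^ 2 + 4 * t * |y|) / (8 * t) by field_simp; ring,
      show t / 2 + -y ^ 2 / (8 * t) = (4 * t ^ 2 - y ^ 2) / (8 * t) by field_simp; ring,
      div_le_div_iff_of_pos_right h8]
    nlinarith [sq_nonneg (|y| - 2 * t), sq_abs y]
  have e8 : Real.exp (-(1 / (8 * t)) * y ^ 2) = Real.exp (-y ^ 2 / (8 * t)) := by congr 1; field_simp
  rw [e8]
  calc Real.exp (-y ^ 2 / (4 * t)) / (2 * √π * √t) * Real.exp (|y| / 2)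
      = (Real.exp (-y ^ 2 / (4 * t)) * Real.exp (|y| / 2)) / (2 * √π * √t) := by ring
    _ ≤ (Real.exp (t / 2) * Real.exp (-y ^ 2 / (8 * t))) / (2 * √π * √t) :=
        div_le_div_of_nonneg_right key hsq.le
    _ = _ := by ring

/-- **Dominated convergence for the transforms**: if `χ_n` are continuous real cutoffs with `|χ_n| ≤ 1` and
`χ_n(y) = 1` eventually for each `y`, then `(χ_n g_t)^(s) → ĝ_t(s)` for `0 ≤ Re s ≤ 1`. [folklore] -/
private theorem tendsto_weilMellin_cutoff {t : ℝ} (ht : 0 < t) {χ : ℕ → ℝ → ℝ} (hc : ∀ n, Continuous (χ n))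
    (h0 : ∀ n y, |χ n y| ≤ 1) (h1 : ∀ y : ℝ, ∀ᶠ n in atTop, χ n y = 1) {s : ℂ} (hs0 : 0 ≤ s.re)
    (hs1 : s.re ≤ 1) :
    Tendsto (fun n => weilMellin (fun y => (χ n y : ℂ) * heatTest t y) s) atTop
      (𝓝 (weilMellin (heatTest t) s)) := by
  unfold weilMellin
  have hcont : Continuous (heatTest t) := by
    unfold heatTest; fun_prop
  refine tendsto_integral_of_dominated_convergence
    (fun y => Real.exp (-y ^ 2 / (4 * t)) / (2 * √π * √t) * Real.exp (|y| / 2)) (fun n => ?_)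
    (integrable_profile_mul_exp_abs ht) (fun n => Eventually.of_forall fun y => ?_) (Eventually.of_forall fun y => ?_)
  · exact (((Complex.continuous_ofReal.comp (hc n)).mul hcont).mul (by fun_prop)).aestronglyMeasurable
  · rw [norm_mul, norm_mul, Complex.norm_real, Complex.norm_exp]
    have hg : ‖heatTest t y‖ = Real.exp (-y ^ 2 / (4 * t)) / (2 * √π * √t) := by
      rw [heatTest, Complex.norm_real, Real.norm_of_nonneg]
      have : 0 < √π := Real.sqrt_pos.mpr Real.pi_pos
      have : 0 < √t := Real.sqrt_pos.mpr ht
      positivity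
    have hre : ((s - 1 / 2) * (y : ℂ)).re ≤ |y| / 2 := by
      have e : ((s - 1 / 2) * (y : ℂ)).re = (s.re - 1 / 2) * y := by simp [sub_re, mul_re]
      rw [e]
      have h1 : |s.re - 1 / 2| ≤ 1 / 2 := abs_le.2 ⟨by linarith, by linarith⟩
      calc (s.re - 1 / 2) * y ≤ |(s.re - 1 / 2) * y| := le_abs_self _
        _ = |s.re - 1 / 2| * |y| := abs_mul _ _
        _ ≤ 1 / 2 * |y| := mul_le_mul_of_nonneg_right h1 (abs_nonneg _)
        _ = |y| / 2 := by ring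
    rw [hg, Real.norm_eq_abs]
    have hpos : 0 ≤ Real.exp (-y ^ 2 / (4 * t)) / (2 * √π * √t) := by rw [← hg]; exact norm_nonneg _
    calc |χ n y| * (Real.exp (-y ^ 2 / (4 * t)) / (2 * √π * √t)) * Real.exp (((s - 1 / 2) * (y : ℂ)).re)
        ≤ 1 * (Real.exp (-y ^ 2 / (4 * t)) / (2 * √π * √t)) * Real.exp (|y| / 2) := by
          gcongr
          exact h0 n y
      _ = _ := by ring
  · have hev : ∀ᶠ n in atTop, (χ n y : ℂ) * heatTest t y * cexp ((s - 1 / 2) * y) =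
        heatTest t y * cexp ((s - 1 / 2) * y) := by
      filter_upwards [h1 y] with n hn
      rw [hn]; push_cast; ring
    exact (tendsto_congr' hev).mpr tendsto_const_nhds

/-! ## Elementary facts about the heat test function -/

/-- `g_t` is even. [folklore] -/
private theorem heatTest_neg (t y : ℝ) : heatTest t (-y) = heatTest t y := by
  simp [heatTest]

/-- `‖g_t(y)‖ = h_t(y)`. [folklore] -/
private theorem norm_heatTest {t : ℝ} (ht : 0 < t) (y : ℝ) :
    ‖heatTest t y‖ = Real.exp (-y ^ 2 / (4 * t)) / (2 * √π * √t) := by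
  rw [heatTest, Complex.norm_real, Real.norm_of_nonneg]
  have : 0 < √π := Real.sqrt_pos.mpr Real.pi_pos
  have : 0 < √t := Real.sqrt_pos.mpr ht
  positivity

/-- `h_t(y) ≤ h_t(0)`. [folklore] -/
private theorem profile_le_zero {t : ℝ} (ht : 0 < t) (y : ℝ) :
    Real.exp (-y ^ 2 / (4 * t)) / (2 * √π * √t) ≤ 1 / (2 * √π * √t) := by
  have hsq : 0 < 2 * √π * √t := by
    have : 0 < √π := Real.sqrt_pos.mpr Real.pi_pos
    have : 0 < √t := Real.sqrt_pos.mpr ht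
    positivity
  refine div_le_div_of_nonneg_right ?_ hsq.le
  rw [Real.exp_le_one_iff]
  have : 0 ≤ y ^ 2 / (4 * t) := by positivity
  have e : -y ^ 2 / (4 * t) = -(y ^ 2 / (4 * t)) := by ring
  linarith

/-- `g_t` is continuous. [folklore] -/
private theorem continuous_heatTest (t : ℝ) : Continuous (heatTest t) := by
  unfold heatTest; fun_prop

/-! ## The prime term along the cutoffs -/

/-- **Prime side**: for `0 < t ≤ (log 6)/8` and cutoffs `χ_n` with `|χ_n| ≤ 1`, `χ_n(y) = 1` eventually for each
`y`, `Σ_n Λ(n)n^{−½}((χ_n g_t)(log n) + (χ_n g_t)(−log n)) → Σ_n Λ(n)n^{−½}(g_t(log n) + g_t(−log n))` (dominated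
by the convergent `ψ(t)`, `summable_heatPrimeTerm`). [folklore] -/
private theorem tendsto_weilPrimeTerm_cutoff {t : ℝ} (ht : 0 < t) (ht0 : t ≤ Real.log 6 / 8) {χ : ℕ → ℝ → ℝ}
    (h0 : ∀ n y, |χ n y| ≤ 1) (h1 : ∀ y : ℝ, ∀ᶠ n in atTop, χ n y = 1) :
    Tendsto (fun n => weilPrimeTerm (fun y => (χ n y : ℂ) * heatTest t y)) atTop
      (𝓝 (weilPrimeTerm (heatTest t))) := by
  unfold weilPrimeTerm
  refine tendsto_tsum_of_dominated_convergence (bound := heatPrimeTerm t) (summable_heatPrimeTerm ht ht0)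
    (fun k => ?_) (Eventually.of_forall fun n k => ?_)
  · have hev : ∀ᶠ n in atTop, ((ArithmeticFunction.vonMangoldt k : ℝ) : ℂ) / (Real.sqrt k : ℂ) *
        ((χ n (Real.log k) : ℂ) * heatTest t (Real.log k) + (χ n (-Real.log k) : ℂ) * heatTest t (-Real.log k))
          = ((ArithmeticFunction.vonMangoldt k : ℝ) : ℂ) / (Real.sqrt k : ℂ) *
            (heatTest t (Real.log k) + heatTest t (-Real.log k)) := by
      filter_upwards [h1 (Real.log k), h1 (-Real.log k)] with n hn hn'
      rw [hn, hn']; push_cast; ring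
    exact (tendsto_congr' hev).mpr tendsto_const_nhds
  · have hΛ : 0 ≤ (ArithmeticFunction.vonMangoldt k : ℝ) := ArithmeticFunction.vonMangoldt_nonneg
    have hc : ‖((ArithmeticFunction.vonMangoldt k : ℝ) : ℂ) / (Real.sqrt k : ℂ)‖ =
        (ArithmeticFunction.vonMangoldt k : ℝ) / Real.sqrt k := by
      rw [norm_div, Complex.norm_real, Complex.norm_real, Real.norm_of_nonneg hΛ,
        Real.norm_of_nonneg (Real.sqrt_nonneg _)]
    rw [norm_mul, hc, heatPrimeTerm]
    have hsum : ‖(χ n (Real.log k) : ℂ) * heatTest t (Real.log k) +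
        (χ n (-Real.log k) : ℂ) * heatTest t (-Real.log k)‖ ≤
          Real.exp (-Real.log k ^ 2 / (4 * t)) / (√π * √t) := by
      refine (norm_add_le _ _).trans ?_
      rw [norm_mul, norm_mul, Complex.norm_real, Complex.norm_real, heatTest_neg, norm_heatTest ht,
        Real.norm_eq_abs, Real.norm_eq_abs]
      have hh : 0 ≤ Real.exp (-Real.log k ^ 2 / (4 * t)) / (2 * √π * √t) := by
        rw [← norm_heatTest ht]; exact norm_nonneg _
      have hsq : 0 < √π * √t := mul_pos (Real.sqrt_pos.mpr Real.pi_pos) (Real.sqrt_pos.mpr ht)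
      calc |χ n (Real.log k)| * (Real.exp (-Real.log k ^ 2 / (4 * t)) / (2 * √π * √t)) +
            |χ n (-Real.log k)| * (Real.exp (-Real.log k ^ 2 / (4 * t)) / (2 * √π * √t))
          ≤ 1 * (Real.exp (-Real.log k ^ 2 / (4 * t)) / (2 * √π * √t)) +
            1 * (Real.exp (-Real.log k ^ 2 / (4 * t)) / (2 * √π * √t)) := by
            gcongr
            · exact h0 n _
            · exact h0 n _
        _ = Real.exp (-Real.log k ^ 2 / (4 * t)) / (√π * √t) := by field_simp; ring
    exact mul_le_mul_of_nonneg_left hsum (div_nonneg hΛ (Real.sqrt_nonneg _))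

/-! ## Bombieri's archimedean term along the cutoffs -/

/-- Near `0`: `|e^{y/2} h_t(y) − h_t(0)| ≤ L y` on `[0, 1]`, `L = e^{1/2} h_t(0) (1/2 + 1/2t)` (mean value
inequality). [folklore] -/
private theorem abs_exp_mul_profile_sub_le {t : ℝ} (ht : 0 < t) {y : ℝ} (hy0 : 0 ≤ y) (hy1 : y ≤ 1) :
    |Real.exp (y / 2) * (Real.exp (-y ^ 2 / (4 * t)) / (2 * √π * √t)) - 1 / (2 * √π * √t)| ≤
      Real.exp (1 / 2) * (1 / (2 * √π * √t)) * (1 / 2 + 1 / (2 * t)) * y := by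
  have hsq : 0 < 2 * √π * √t := by
    have : 0 < √π := Real.sqrt_pos.mpr Real.pi_pos
    have : 0 < √t := Real.sqrt_pos.mpr ht
    positivity
  set φ : ℝ → ℝ := fun u => Real.exp (u / 2) * (Real.exp (-u ^ 2 / (4 * t)) / (2 * √π * √t)) with hφ
  set φ' : ℝ → ℝ := fun u => Real.exp (u / 2) * (Real.exp (-u ^ 2 / (4 * t)) / (2 * √π * √t)) *
    (1 / 2 - u / (2 * t)) with hφ'
  have hderiv : ∀ u : ℝ, HasDerivAt φ (φ' u) u := by
    intro u
    have h1 : HasDerivAt (fun u : ℝ => Real.exp (u / 2)) (Real.exp (u / 2) * (1 / 2)) u := by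
      have := ((hasDerivAt_id u).div_const 2).exp
      simpa using this
    have h2 : HasDerivAt (fun u : ℝ => Real.exp (-u ^ 2 / (4 * t)) / (2 * √π * √t))
        (-(u / (2 * t)) * (Real.exp (-u ^ 2 / (4 * t)) / (2 * √π * √t))) u := by
      have h1' : HasDerivAt (fun u : ℝ => -u ^ 2 / (4 * t)) (-(2 * u) / (4 * t)) u := by
        have := ((hasDerivAt_pow 2 u).neg).div_const (4 * t)
        simpa using this
      have h2' := (h1'.exp).div_const (2 * √π * √t)
      refine h2'.congr_deriv ?_
      field_simp
      ring
    refine (h1.mul h2).congr_deriv ?_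
    simp only [hφ']
    ring
  have hbound : ∀ u ∈ Ico (0 : ℝ) 1, ‖φ' u‖ ≤ Real.exp (1 / 2) * (1 / (2 * √π * √t)) * (1 / 2 + 1 / (2 * t)) := by
    intro u hu
    rw [Real.norm_eq_abs, hφ']
    simp only
    rw [abs_mul, abs_mul, abs_of_pos (Real.exp_pos _)]
    have e1 : Real.exp (u / 2) ≤ Real.exp (1 / 2) := Real.exp_le_exp.mpr (by linarith [hu.2])
    have e2 : |Real.exp (-u ^ 2 / (4 * t)) / (2 * √π * √t)| ≤ 1 / (2 * √π * √t) := by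
      rw [abs_of_nonneg (by positivity)]; exact profile_le_zero ht u
    have e3 : |1 / 2 - u / (2 * t)| ≤ 1 / 2 + 1 / (2 * t) := by
      refine (abs_sub _ _).trans ?_
      rw [abs_of_pos (by norm_num : (0 : ℝ) < 1 / 2), abs_div, abs_of_nonneg hu.1,
        abs_of_pos (by linarith : (0 : ℝ) < 2 * t)]
      gcongr
      · exact hu.2.le
    exact mul_le_mul (mul_le_mul e1 e2 (abs_nonneg _) (Real.exp_pos _).le) e3 (abs_nonneg _)
      (by positivity)
  have hf : ∀ u ∈ Icc (0 : ℝ) 1, HasDerivWithinAt φ (φ' u) (Icc (0 : ℝ) 1) u :=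
    fun u _ => (hderiv u).hasDerivWithinAt
  have h := norm_image_sub_le_of_norm_deriv_le_segment' hf hbound y ⟨hy0, hy1⟩
  rw [Real.norm_eq_abs, sub_zero] at h
  have hφ0 : φ 0 = 1 / (2 * √π * √t) := by simp [hφ]
  rw [hφ0] at h
  simpa [hφ] using h

/-- `2 sinh y ≥ e^y/2... precisely `e^{−y} ≤ 4 e^{−y}·sinh y`-type bound: for `y ≥ 1`, `1/(2 sinh y) ≤ 2e^{−y}`.
[folklore] -/
private theorem inv_two_sinh_le {y : ℝ} (hy : 1 ≤ y) : 1 / (2 * Real.sinh y) ≤ 2 * Real.exp (-y) := by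
  have hs : 0 < Real.sinh y := Real.sinh_pos_iff.mpr (by linarith)
  rw [div_le_iff₀ (by linarith), Real.sinh_eq]
  have h1 : Real.exp (-y) ≤ Real.exp (-1) := Real.exp_le_exp.mpr (by linarith)
  have h2 : Real.exp (-1) ≤ 1 / 2 := by
    have := Real.exp_one_gt_d9
    rw [Real.exp_neg, inv_eq_one_div, div_le_div_iff_of_pos_left one_pos (Real.exp_pos 1) two_pos]
    linarith
  have h3 : Real.exp y * Real.exp (-y) = 1 := by rw [← Real.exp_add]; simp
  nlinarith [Real.exp_pos (-y), Real.exp_pos y]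

/-- **Bombieri's archimedean integral along the cutoffs**: for continuous cutoffs `χ_n` with `|χ_n| ≤ 1`,
`χ_n = 1` on `[−1, 1]`, and `χ_n(y) = 1` eventually for each `y`,
`∫₀^∞ (e^{y/2}((χ_n g_t)(y) + (χ_n g_t)(−y)) − 2(χ_n g_t)(0))/(2 sinh y) dy → ∫₀^∞ (e^{y/2}(g_t(y) + g_t(−y)) − 2g_t(0))/(2 sinh y) dy`
(dominated convergence; near `0` the integrands coincide). [folklore] -/
private theorem tendsto_bombieriIntegral_cutoff {t : ℝ} (ht : 0 < t) {χ : ℕ → ℝ → ℝ} (hc : ∀ n, Continuous (χ n))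
    (h0 : ∀ n y, |χ n y| ≤ 1) (hone : ∀ n y, |y| ≤ 1 → χ n y = 1) (h1 : ∀ y : ℝ, ∀ᶠ n in atTop, χ n y = 1) :
    Tendsto (fun n => ∫ y in Ioi (0 : ℝ),
      ((Real.exp (y / 2) : ℂ) * ((χ n y : ℂ) * heatTest t y + (χ n (-y) : ℂ) * heatTest t (-y)) -
        2 * ((χ n 0 : ℂ) * heatTest t 0)) / (2 * Real.sinh y : ℂ)) atTop
      (𝓝 (∫ y in Ioi (0 : ℝ), ((Real.exp (y / 2) : ℂ) * (heatTest t y + heatTest t (-y)) - 2 * heatTest t 0) /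
        (2 * Real.sinh y : ℂ))) := by
  have hsq : 0 < 2 * √π * √t := by
    have : 0 < √π := Real.sqrt_pos.mpr Real.pi_pos
    have : 0 < √t := Real.sqrt_pos.mpr ht
    positivity
  set h : ℝ → ℝ := fun y => Real.exp (-y ^ 2 / (4 * t)) / (2 * √π * √t) with hh
  have hg : ∀ y, heatTest t y = ((h y : ℝ) : ℂ) := fun y => rfl
  have hhneg : ∀ y, h (-y) = h y := fun y => by simp [hh]
  have hh0 : h 0 = 1 / (2 * √π * √t) := by simp [hh]
  have hhle : ∀ y, h y ≤ h 0 := fun y => by rw [hh0]; exact profile_le_zero ht y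
  have hhpos : ∀ y, 0 < h y := fun y => by simp only [hh]; positivity
  -- the limit integrand is real: `((e^{y/2} h(y) − h(0))/sinh y : ℝ)`
  set I : ℝ → ℂ := fun y => ((Real.exp (y / 2) : ℂ) * (heatTest t y + heatTest t (-y)) - 2 * heatTest t 0) /
    (2 * Real.sinh y : ℂ) with hI
  have hIreal : ∀ y, 0 < y → I y = (((Real.exp (y / 2) * h y - h 0) / Real.sinh y : ℝ) : ℂ) := by
    intro y hy
    have hs : Real.sinh y ≠ 0 := (Real.sinh_pos_iff.mpr hy).ne'
    simp only [hI, hg, hhneg]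
    push_cast
    field_simp
    ring
  -- the dominating function
  set L : ℝ := Real.exp (1 / 2) * (1 / (2 * √π * √t)) * (1 / 2 + 1 / (2 * t)) with hL
  set Bd : ℝ → ℝ := fun y => if y ≤ 1 then L else (Real.exp (y / 2) * (2 * h y) + 2 * h 0) / (2 * Real.sinh y)
    with hBd
  -- `‖I y‖ ≤ L` on `(0, 1]`
  have hIle : ∀ y, 0 < y → y ≤ 1 → ‖I y‖ ≤ L := by
    intro y hy hy1
    rw [hIreal y hy, Complex.norm_real, Real.norm_eq_abs, abs_div,
      abs_of_pos (Real.sinh_pos_iff.mpr hy), div_le_iff₀ (Real.sinh_pos_iff.mpr hy), hh0]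
    have h1 := abs_exp_mul_profile_sub_le ht hy.le hy1
    have hys : y ≤ Real.sinh y := Real.self_le_sinh_iff.mpr hy.le
    have hL0 : 0 ≤ L := by positivity
    calc |Real.exp (y / 2) * h y - 1 / (2 * √π * √t)| ≤ L * y := h1
      _ ≤ L * Real.sinh y := mul_le_mul_of_nonneg_left hys hL0
  -- integrability of the dominating function on `(0, ∞)`
  have hBdint : IntegrableOn Bd (Ioi 0) := by
    rw [← Ioc_union_Ioi_eq_Ioi zero_le_one, integrableOn_union]
    constructor
    · have hconst : IntegrableOn (fun _ : ℝ => L) (Ioc 0 1) := integrableOn_const (by simp [Real.volume_Ioc])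
      refine hconst.congr_fun (fun y hy => ?_) measurableSet_Ioc
      simp [hBd, hy.2]
    · have hmaj : IntegrableOn (fun y : ℝ => (Real.exp (y / 2) * (2 * h y) + 2 * h 0) * (2 * Real.exp (-y)))
          (Ioi 1) := by
        have i1 : IntegrableOn (fun y : ℝ => Real.exp (-(1 / 2) * y)) (Ioi 1) :=
          exp_neg_integrableOn_Ioi 1 (by norm_num : (0 : ℝ) < 1 / 2)
        have i2 : IntegrableOn (fun y : ℝ => Real.exp (-1 * y)) (Ioi 1) :=
          exp_neg_integrableOn_Ioi 1 (zero_lt_one : (0 : ℝ) < 1)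
        have i3 := (i1.const_mul (4 * h 0)).add (i2.const_mul (4 * h 0))
        refine i3.mono' ?_ ?_
        · refine ContinuousOn.aestronglyMeasurable ?_ measurableSet_Ioi
          simp only [hh]
          fun_prop
        · refine (ae_restrict_iff' measurableSet_Ioi).2 (Eventually.of_forall fun y (hy : 1 < y) => ?_)
          have hpos : 0 ≤ (Real.exp (y / 2) * (2 * h y) + 2 * h 0) * (2 * Real.exp (-y)) := by
            have := hhpos y; have := hhpos 0; positivity
          rw [Real.norm_of_nonneg hpos, Pi.add_apply]
          have e1 : Real.exp (y / 2) * Real.exp (-y) = Real.exp (-(1 / 2) * y) := by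
            rw [← Real.exp_add]; ring_nf
          have e2 : Real.exp (-1 * y) = Real.exp (-y) := by ring_nf
          calc (Real.exp (y / 2) * (2 * h y) + 2 * h 0) * (2 * Real.exp (-y))
              = 4 * h y * (Real.exp (y / 2) * Real.exp (-y)) + 4 * h 0 * Real.exp (-y) := by ring
            _ ≤ 4 * h 0 * (Real.exp (y / 2) * Real.exp (-y)) + 4 * h 0 * Real.exp (-y) := by
                gcongr
                · exact hhle y
            _ = 4 * h 0 * Real.exp (-(1 / 2) * y) + 4 * h 0 * Real.exp (-1 * y) := by rw [e1, e2]
      have hI1 : IntegrableOn (fun y : ℝ => (Real.exp (y / 2) * (2 * h y) + 2 * h 0) / (2 * Real.sinh y))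
          (Ioi 1) := by
        refine hmaj.mono' ?_ ?_
        · refine ContinuousOn.aestronglyMeasurable ?_ measurableSet_Ioi
          refine ContinuousOn.div (by simp only [hh]; fun_prop) (by fun_prop) fun y (hy : 1 < y) => ?_
          exact (mul_pos two_pos (Real.sinh_pos_iff.mpr (by linarith))).ne'
        · refine (ae_restrict_iff' measurableSet_Ioi).2 (Eventually.of_forall fun y (hy : 1 < y) => ?_)
          have hnum : 0 ≤ Real.exp (y / 2) * (2 * h y) + 2 * h 0 := by
            have := hhpos y; have := hhpos 0; positivity
          have hs : 0 < 2 * Real.sinh y := mul_pos two_pos (Real.sinh_pos_iff.mpr (by linarith))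
          rw [Real.norm_of_nonneg (div_nonneg hnum hs.le), div_eq_mul_one_div]
          exact mul_le_mul_of_nonneg_left (inv_two_sinh_le hy.le) hnum
      refine hI1.congr_fun (fun y (hy : 1 < y) => ?_) measurableSet_Ioi
      simp [hBd, not_le.mpr hy]
  -- dominated convergence on `(0, ∞)`
  refine tendsto_integral_of_dominated_convergence Bd (fun n => ?_) hBdint (fun n => ?_) ?_
  · refine ContinuousOn.aestronglyMeasurable ?_ measurableSet_Ioi
    have hcn := hc n
    have hct := continuous_heatTest t
    refine ContinuousOn.div (Continuous.continuousOn (by fun_prop)) (by fun_prop) fun y (hy : 0 < y) => ?_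
    exact_mod_cast (mul_pos two_pos (Real.sinh_pos_iff.mpr hy)).ne'
  · refine (ae_restrict_iff' measurableSet_Ioi).2 (Eventually.of_forall fun y (hy : 0 < y) => ?_)
    rcases le_or_gt y 1 with hy1 | hy1
    · -- the integrands coincide on `(0, 1]`
      have e1 : χ n y = 1 := hone n y (by rw [abs_of_pos hy]; exact hy1)
      have e2 : χ n (-y) = 1 := hone n (-y) (by rw [abs_neg, abs_of_pos hy]; exact hy1)
      have e3 : χ n 0 = 1 := hone n 0 (by simp)
      rw [e1, e2, e3]
      simp only [Complex.ofReal_one, one_mul]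
      have := hIle y hy hy1
      simp only [hI] at this
      simp only [hBd, if_pos hy1]
      exact this
    · have hs : 0 < 2 * Real.sinh y := mul_pos two_pos (Real.sinh_pos_iff.mpr hy)
      have hsC : ‖(2 * Real.sinh y : ℂ)‖ = 2 * Real.sinh y := by
        rw [show (2 * Real.sinh y : ℂ) = ((2 * Real.sinh y : ℝ) : ℂ) by push_cast; ring, Complex.norm_real,
          Real.norm_of_nonneg hs.le]
      simp only [hBd, if_neg (not_le.mpr hy1)]
      rw [norm_div, hsC, div_le_div_iff_of_pos_right hs]
      refine (norm_sub_le _ _).trans ?_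
      rw [norm_mul, Complex.norm_real, Real.norm_of_nonneg (Real.exp_pos _).le, norm_mul, Complex.norm_two,
        norm_mul, Complex.norm_real, hg 0, Complex.norm_real, Real.norm_of_nonneg (hhpos 0).le, Real.norm_eq_abs]
      have hin : ‖(χ n y : ℂ) * heatTest t y + (χ n (-y) : ℂ) * heatTest t (-y)‖ ≤ 2 * h y := by
        refine (norm_add_le _ _).trans ?_
        rw [norm_mul, norm_mul, Complex.norm_real, Complex.norm_real, hg, hg, hhneg, Complex.norm_real,
          Real.norm_of_nonneg (hhpos y).le, Real.norm_eq_abs, Real.norm_eq_abs]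
        have hy0 := (hhpos y).le
        calc |χ n y| * h y + |χ n (-y)| * h y ≤ 1 * h y + 1 * h y :=
              add_le_add (mul_le_mul_of_nonneg_right (h0 n y) hy0)
                (mul_le_mul_of_nonneg_right (h0 n (-y)) hy0)
          _ = 2 * h y := by ring
      refine add_le_add (mul_le_mul_of_nonneg_left hin (Real.exp_pos _).le) ?_
      have := h0 n 0
      have := hhpos 0
      nlinarith [abs_nonneg (χ n 0)]
  · refine (ae_restrict_iff' measurableSet_Ioi).2 (Eventually.of_forall fun y (hy : 0 < y) => ?_)
    have hev : ∀ᶠ n in atTop,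
        ((Real.exp (y / 2) : ℂ) * ((χ n y : ℂ) * heatTest t y + (χ n (-y) : ℂ) * heatTest t (-y)) -
          2 * ((χ n 0 : ℂ) * heatTest t 0)) / (2 * Real.sinh y : ℂ) = I y := by
      filter_upwards [h1 y, h1 (-y), h1 0] with n e1 e2 e3
      rw [e1, e2, e3]; simp only [Complex.ofReal_one, one_mul, hI]
    exact (tendsto_congr' hev).mpr tendsto_const_nhds

/-! ## Assembly: the explicit formula for the Gaussian, under RH -/

/-- Bombieri's archimedean term of the Gaussian, in real form:
`W_∞^{Bombieri}(g_t) = −((log 4π + γ)/(2√π√t) + ∫₀^∞ (e^{y/2} h_t(y) − h_t(0))/sinh y dy)` — the printed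
`−W_ℝ(F_t)` with `W_ℝ(F) = (log 4π + γ)F(1) + ∫₀^∞ (F(e^u) + F(e^{−u}) − 2e^{−u/2}F(1)) e^{u/2}/(e^u − e^{−u}) du`.
[cite: Connes2024HeatExpansion, §3, display for `W_ℝ(F_t)` (arXiv p0005:L14)] -/
theorem weilArchTermBombieri_heatTest (t : ℝ) :
    weilArchTermBombieri (heatTest t) =
      -((((Real.log (4 * π) + Real.eulerMascheroniConstant) * (1 / (2 * √π * √t)) +
        ∫ y in Ioi (0 : ℝ), (Real.exp (y / 2) * (Real.exp (-y ^ 2 / (4 * t)) / (2 * √π * √t)) -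
          1 / (2 * √π * √t)) / Real.sinh y : ℝ) : ℂ)) := by
  unfold weilArchTermBombieri
  have h0 : heatTest t 0 = ((1 / (2 * √π * √t) : ℝ) : ℂ) := by simp [heatTest]
  have hI : ∫ y in Ioi (0 : ℝ), ((Real.exp (y / 2) : ℂ) * (heatTest t y + heatTest t (-y)) - 2 * heatTest t 0) /
      (2 * Real.sinh y : ℂ) = ∫ y in Ioi (0 : ℝ), (((Real.exp (y / 2) * (Real.exp (-y ^ 2 / (4 * t)) / (2 * √π * √t)) -
        1 / (2 * √π * √t)) / Real.sinh y : ℝ) : ℂ) := by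
    refine setIntegral_congr_fun measurableSet_Ioi fun y (hy : 0 < y) => ?_
    have hs : (Real.sinh y : ℂ) ≠ 0 := by exact_mod_cast (Real.sinh_pos_iff.mpr hy).ne'
    rw [h0]
    simp only [heatTest]
    push_cast
    field_simp
    ring
  rw [hI, integral_complex_ofReal, h0]
  push_cast
  ring

/-- **The explicit formula for the Gaussian test function** (Connes 2024 §§2–3 = [EB] for `F_t`), UNDER RH, for
`0 < t ≤ (log 6)/8`: the absolutely convergent zero side `Σ'_ρ m(ρ) ĝ_t(ρ)` equals
`(ĝ_t(0) + ĝ_t(1)) − Σ_n Λ(n)n^{−½}(g_t(log n) + g_t(−log n)) + W_∞^{Bombieri}(g_t)`. [cite: Connes2024HeatExpansion, §3, display `Σ_Z exp(−tρ²) = F̂_t(i/2)+F̂_t(−i/2)−W_ℝ(F_t)−ψ(t)` (arXiv p0005:L8)] -/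
theorem tsum_zeroSide_heatTest (hRH : RiemannHypothesis) {t : ℝ} (ht : 0 < t) (ht0 : t ≤ Real.log 6 / 8) :
    ∑' ρ : ZetaZeros.riemannZetaNontrivialZeros, (riemannZetaZeroOrder (ρ : ℂ) : ℂ) * weilMellin (heatTest t) ρ =
      weilPolarTerm (heatTest t) - weilPrimeTerm (heatTest t) + weilArchTermBombieri (heatTest t) := by
  -- the cutoffs
  obtain ⟨M, hM1, hM, hM'⟩ := exists_bound_deriv_smoothTransition
  set χ : ℕ → ℝ → ℝ := fun n y => Real.smoothTransition (((n : ℝ) + 2) - y) * Real.smoothTransition (((n : ℝ) + 2) + y)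
    with hχ
  have hχc : ∀ n, ContDiff ℝ ∞ (χ n) := fun n => contDiff_cutoff _
  have hχs : ∀ n, HasCompactSupport (χ n) := fun n => hasCompactSupport_cutoff _
  have hχ0 : ∀ n y, |χ n y| ≤ 1 := fun n y => abs_cutoff_le_one _ _
  have hχcont : ∀ n, Continuous (χ n) := fun n => (hχc n).continuous
  set B : ℝ := 4 * M ^ 2 with hB
  have hB1 : 1 ≤ B := by rw [hB]; nlinarith
  have hχ1 : ∀ n y, |deriv (χ n) y| ≤ B := fun n y => by
    have := (abs_deriv_cutoff_le hM1 hM hM' ((n : ℝ) + 2) y).1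
    rw [hB]; nlinarith
  have hχ2 : ∀ n y, |deriv (deriv (χ n)) y| ≤ B := fun n y => (abs_deriv_cutoff_le hM1 hM hM' ((n : ℝ) + 2) y).2
  have hone : ∀ n y, |y| ≤ 1 → χ n y = 1 := fun n y hy =>
    cutoff_eq_one (by have : (0 : ℝ) ≤ n := Nat.cast_nonneg n; linarith)
  have hev : ∀ y : ℝ, ∀ᶠ n in atTop, χ n y = 1 := by
    intro y
    refine Filter.eventually_atTop.2 ⟨⌈|y|⌉₊, fun n hn => cutoff_eq_one ?_⟩
    have h1 : |y| ≤ ⌈|y|⌉₊ := Nat.le_ceil _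
    have h2 : (⌈|y|⌉₊ : ℝ) ≤ n := by exact_mod_cast hn
    linarith
  -- the cut-off Gaussians
  set g : ℕ → ℝ → ℂ := fun n y => (χ n y : ℂ) * heatTest t y with hg
  have hW : ∀ n, IsWeilTest (g n) := fun n => isWeilTest_cutoff_mul (hχc n) (hχs n)
  set D : ℝ := 2 * (Real.exp (t / 2) / (2 * √π * √t) *
    ∫ y : ℝ, (B + 1 / (2 * t) + B / t * |y| + 1 / (4 * t ^ 2) * y ^ 2) * Real.exp (-y ^ 2 / (8 * t))) with hD
  have hDle : ∀ n, weilDecayConst (g n) ≤ D := fun n =>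
    weilDecayConst_cutoff_mul_le ht (hχc n) hB1 (hχ0 n) (hχ1 n) (hχ2 n)
  have hbound : ∀ n (ρ : ℂ), ρ ∈ ZetaZeros.riemannZetaNontrivialZeros →
      ‖weilMellin (g n) ρ‖ ≤ D / (1 + ρ.im ^ 2) := by
    intro n ρ hρ
    have h1 := norm_weilMellin_le (hW n) (ZetaZeros.riemannZetaNontrivialZeros.re_pos hρ).le
      (ZetaZeros.riemannZetaNontrivialZeros.re_lt_one hρ).le
    exact h1.trans (div_le_div_of_nonneg_right (hDle n) (by positivity))
  -- absolute convergence of the zero sides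
  have hm0 : ∀ ρ : ZetaZeros.riemannZetaNontrivialZeros, (0 : ℝ) ≤ riemannZetaZeroOrder (ρ : ℂ) := fun ρ => by
    exact_mod_cast riemannZetaZeroOrder_nonneg (ZetaZeros.riemannZetaNontrivialZeros.ne_one ρ.2)
  have hS := (summable_zeroOrder_div_one_add_im_sq hRH).mul_left D
  have hnorm : ∀ n (ρ : ZetaZeros.riemannZetaNontrivialZeros),
      ‖(riemannZetaZeroOrder (ρ : ℂ) : ℂ) * weilMellin (g n) ρ‖ ≤
        D * ((riemannZetaZeroOrder (ρ : ℂ) : ℝ) / (1 + (ρ : ℂ).im ^ 2)) := by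
    intro n ρ
    rw [norm_mul, Complex.norm_intCast, abs_of_nonneg (hm0 ρ)]
    calc (riemannZetaZeroOrder (ρ : ℂ) : ℝ) * ‖weilMellin (g n) ρ‖
        ≤ (riemannZetaZeroOrder (ρ : ℂ) : ℝ) * (D / (1 + (ρ : ℂ).im ^ 2)) :=
          mul_le_mul_of_nonneg_left (hbound n ρ ρ.2) (hm0 ρ)
      _ = _ := by ring
  have hZ : ∀ n, Summable fun ρ : ZetaZeros.riemannZetaNontrivialZeros =>
      ‖(riemannZetaZeroOrder (ρ : ℂ) : ℂ) * weilMellin (g n) ρ‖ := fun n =>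
    Summable.of_nonneg_of_le (fun _ => norm_nonneg _) (hnorm n) hS
  -- the explicit formula for each `g_n`
  have hEF : ∀ n, ∑' ρ : ZetaZeros.riemannZetaNontrivialZeros,
      (riemannZetaZeroOrder (ρ : ℂ) : ℂ) * weilMellin (g n) ρ =
        weilPolarTerm (g n) - weilPrimeTerm (g n) + weilArchTermBombieri (g n) := fun n =>
    tsum_zeroSide_eq_bombieri_of_isWeilTest (hW n) (hZ n)
  -- limits of the four terms
  have L1 : Tendsto (fun n => ∑' ρ : ZetaZeros.riemannZetaNontrivialZeros,
      (riemannZetaZeroOrder (ρ : ℂ) : ℂ) * weilMellin (g n) ρ) atTop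
      (𝓝 (∑' ρ : ZetaZeros.riemannZetaNontrivialZeros,
        (riemannZetaZeroOrder (ρ : ℂ) : ℂ) * weilMellin (heatTest t) ρ)) := by
    refine tendsto_tsum_of_dominated_convergence hS (fun ρ => ?_) (Eventually.of_forall fun n ρ => hnorm n ρ)
    exact (tendsto_weilMellin_cutoff ht hχcont hχ0 hev
      (ZetaZeros.riemannZetaNontrivialZeros.re_pos ρ.2).le
      (ZetaZeros.riemannZetaNontrivialZeros.re_lt_one ρ.2).le).const_mul _
  have L2 : Tendsto (fun n => weilPolarTerm (g n)) atTop (𝓝 (weilPolarTerm (heatTest t))) := by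
    unfold weilPolarTerm
    exact (tendsto_weilMellin_cutoff ht hχcont hχ0 hev (by simp) (by simp)).add
      (tendsto_weilMellin_cutoff ht hχcont hχ0 hev (by simp) (by simp))
  have L3 : Tendsto (fun n => weilPrimeTerm (g n)) atTop (𝓝 (weilPrimeTerm (heatTest t))) :=
    tendsto_weilPrimeTerm_cutoff ht ht0 hχ0 hev
  have L4 : Tendsto (fun n => weilArchTermBombieri (g n)) atTop (𝓝 (weilArchTermBombieri (heatTest t))) := by
    unfold weilArchTermBombieri
    have h := tendsto_bombieriIntegral_cutoff ht hχcont hχ0 hone hev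
    refine Tendsto.congr' (Eventually.of_forall fun n => ?_)
      (((tendsto_const_nhds (x := (Real.log (4 * π) + Real.eulerMascheroniConstant : ℂ) * heatTest t 0)).add
        h).neg)
    have h1 : χ n 0 = 1 := hone n 0 (by simp)
    simp only [hg, h1, Complex.ofReal_one, one_mul]
  have L := (L2.sub L3).add L4
  have L' : Tendsto (fun n => ∑' ρ : ZetaZeros.riemannZetaNontrivialZeros,
      (riemannZetaZeroOrder (ρ : ℂ) : ℂ) * weilMellin (g n) ρ) atTop
      (𝓝 (weilPolarTerm (heatTest t) - weilPrimeTerm (heatTest t) + weilArchTermBombieri (heatTest t))) :=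
    L.congr' (Eventually.of_forall fun n => (hEF n).symm)
  exact tendsto_nhds_unique L1 L'

/-- Under RH the zero-side terms of the Gaussian are the heat-trace terms:
`m(ρ) ĝ_t(ρ) = m(ρ) e^{−tγ²}` (`ρ = ½ + iγ`). [cite: Connes2024HeatExpansion, §2 last display and §3 (arXiv p0004:L51, p0005:L8)] -/
theorem zeroSide_term_eq_zetaHeatTerm (hRH : RiemannHypothesis) {t : ℝ} (ht : 0 < t)
    (ρ : ZetaZeros.riemannZetaNontrivialZeros) :
    (riemannZetaZeroOrder (ρ : ℂ) : ℂ) * weilMellin (heatTest t) ρ =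
      ((zetaHeatTerm t ⟨ρ, ρ.2⟩ : ℝ) : ℂ) := by
  have hρ : (ρ : ℂ) = 1 / 2 + (ρ : ℂ).im * I := by
    apply Complex.ext
    · simp [re_eq_half hRH ρ.2]
    · simp
  rw [zetaHeatTerm]
  push_cast
  congr 1
  rw [hρ, weilMellin_heatTest_half_add ht, Complex.ofReal_exp]
  congr 1
  push_cast
  simp

/-- **Under RH the heat trace converges** for every `t > 0` (`e^{−tγ²} ≤ max(1,1/t)/(1+γ²)` and
`Σ m(ρ)/(1+γ²) < ∞`). [cite: Connes2024HeatExpansion, Thm 1.1 (arXiv p0002:L8)] -/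
theorem summable_zetaHeatTerm (hRH : RiemannHypothesis) {t : ℝ} (ht : 0 < t) : Summable (zetaHeatTerm t) := by
  have hS := (summable_zeroOrder_div_one_add_im_sq hRH).mul_left (max 1 (1 / t))
  refine Summable.of_nonneg_of_le (fun ρ => ?_) (fun ρ => ?_) hS
  · have hm : (0 : ℝ) ≤ riemannZetaZeroOrder (ρ : ℂ) := by
      exact_mod_cast riemannZetaZeroOrder_nonneg (ZetaZeros.riemannZetaNontrivialZeros.ne_one ρ.2)
    exact mul_nonneg hm (Real.exp_pos _).le
  · have hm : (0 : ℝ) ≤ riemannZetaZeroOrder (ρ : ℂ) := by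
      exact_mod_cast riemannZetaZeroOrder_nonneg (ZetaZeros.riemannZetaNontrivialZeros.ne_one ρ.2)
    show (riemannZetaZeroOrder (ρ : ℂ) : ℝ) * Real.exp (-t * (ρ : ℂ).im ^ 2) ≤
      max 1 (1 / t) * ((riemannZetaZeroOrder (ρ : ℂ) : ℝ) / (1 + (ρ : ℂ).im ^ 2))
    set x : ℝ := (ρ : ℂ).im ^ 2 with hx
    have hx0 : 0 ≤ x := sq_nonneg _
    -- `e^{-tx} (1 + x) ≤ max 1 (1/t)`
    have key : Real.exp (-t * x) * (1 + x) ≤ max 1 (1 / t) := by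
      have h1 : min 1 t * (1 + x) ≤ 1 + t * x := by
        have := min_le_left 1 t; have := min_le_right 1 t
        have hmin : 0 ≤ min 1 t := le_min zero_le_one ht.le
        nlinarith
      have h2 : 1 + t * x ≤ Real.exp (t * x) := by linarith [Real.add_one_le_exp (t * x)]
      have h3 : Real.exp (-t * x) * Real.exp (t * x) = 1 := by rw [← Real.exp_add]; simp
      have hmin : 0 < min 1 t := lt_min one_pos ht
      have hmax : max 1 (1 / t) = 1 / min 1 t := by
        rcases le_or_gt t 1 with h | h
        · rw [min_eq_right h, max_eq_right (by rw [le_div_iff₀ ht]; linarith)]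
        · rw [min_eq_left h.le, max_eq_left (by rw [div_le_iff₀ ht]; linarith), div_one]
      rw [hmax, le_div_iff₀ hmin]
      nlinarith [Real.exp_pos (-t * x), Real.exp_pos (t * x)]
    have hpos : 0 < 1 + x := by linarith
    calc (riemannZetaZeroOrder (ρ : ℂ) : ℝ) * Real.exp (-t * x)
        = (Real.exp (-t * x) * (1 + x)) * ((riemannZetaZeroOrder (ρ : ℂ) : ℝ) / (1 + x)) := by
          field_simp
      _ ≤ max 1 (1 / t) * ((riemannZetaZeroOrder (ρ : ℂ) : ℝ) / (1 + x)) :=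
          mul_le_mul_of_nonneg_right key (div_nonneg hm hpos.le)

/-- **Connes 2024 §3, the explicit formula for the heat test function, under RH** ("`Σ_Z exp(−tρ²) =
F̂_t(i/2) + F̂_t(−i/2) − W_ℝ(F_t) − ψ(t) = 2exp(t/4) − W_ℝ(F_t) − ψ(t)`"), for `0 < t ≤ (log 6)/8`, in the vocabulary of
`ZetaHeatExpansion.lean`:
`zetaHeatTrace t = 2e^{t/4} − heatPrimeSum t − ((log 4π + γ)/(2√π√t) + ∫₀^∞ (e^{y/2}h_t(y) − h_t(0))/sinh y dy)`.
[cite: Connes2024HeatExpansion, §3, displays for `Σ_Z exp(−tρ²)` and `W_ℝ(F_t)` (arXiv p0005:L8–L16)] -/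
theorem zetaHeatTrace_eq (hRH : RiemannHypothesis) {t : ℝ} (ht : 0 < t) (ht0 : t ≤ Real.log 6 / 8) :
    zetaHeatTrace t = 2 * Real.exp (t / 4) - heatPrimeSum t -
      ((Real.log (4 * π) + Real.eulerMascheroniConstant) * (1 / (2 * √π * √t)) +
        ∫ y in Ioi (0 : ℝ), (Real.exp (y / 2) * (Real.exp (-y ^ 2 / (4 * t)) / (2 * √π * √t)) -
          1 / (2 * √π * √t)) / Real.sinh y) := by
  have h := tsum_zeroSide_heatTest hRH ht ht0
  rw [weilPolarTerm_heatTest ht, weilPrimeTerm_heatTest, weilArchTermBombieri_heatTest t] at h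
  have hz : ∑' ρ : ZetaZeros.riemannZetaNontrivialZeros,
      (riemannZetaZeroOrder (ρ : ℂ) : ℂ) * weilMellin (heatTest t) ρ = ((zetaHeatTrace t : ℝ) : ℂ) := by
    rw [zetaHeatTrace, Complex.ofReal_tsum]
    exact tsum_congr fun ρ => zeroSide_term_eq_zetaHeatTerm hRH ht ρ
  rw [hz] at h
  have h' := congr_arg Complex.re h
  simp only [Complex.ofReal_re, Complex.sub_re, Complex.add_re, Complex.neg_re] at h'
  rw [h']
  ring

end ZetaHeatExplicit

end Literature.NumberTheory.LFunctions

end
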